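import Mathlib
import HarnessLib

/-!
# K3 engine child (stmt-HubbardSuperconductivity-19855), stub `stub_engine_scale0`, clause (E1-v4)₀: which `CE` dominate the
# order-by-order bound

Cell gate-hubbard-kl, seat hubbard-kl-k3c2-p1.  The order-by-order bound of `klAnisoLegKernelNorm_zero_le_order` has the shape
`B^p · Y · (X|U|)^{p-2} · |U|` (`B = 2C_T²/κ₀²`, `Y = 4e⁹κ₀⁴`, `X = 16e⁹κ₀²A₀`); the clause `KernelNormsV4 … 0` asks for
`CE^p · (Klam·|U|)^{p-1}`.  **`orderBound_le_CE_pow`**: any `CE ≥ B·max(1,X)·max(1,Y)·max(1,Klam⁻¹)` dominates, for every `p ≥ 2`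
— the inequality the ENGINE package `Q` (DefsQ4, `CE` by name) has to satisfy.  Pure real algebra.

Everything is proved; no definitions, no named facts, no sorry.
-/

noncomputable section

namespace Summit.HubbardSuperconductivity.HubbardSuperconductivity.Theorems.EngineV8

set_option linter.dupNamespace false -- summit = problem name (single-conjunct summit), D-0017

/-- **`CE ≥ B·max(1,X)·max(1,Y)·max(1,Klam⁻¹)` dominates the order-by-order bound**: for `p ≥ 2`, `X, B ≥ 0`, `Klam > 0`,
`B^p·Y·(X|U|)^{p-2}·|U| ≤ CE^p·(Klam·|U|)^{p-1}`. -/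
theorem orderBound_le_CE_pow {p : ℕ} (hp : 2 ≤ p) {X Y B Klam U CE : ℝ} (hX : 0 ≤ X) (hB : 0 ≤ B)
    (hKlam : 0 < Klam) (hCE : B * max 1 X * max 1 Y * max 1 Klam⁻¹ ≤ CE) :
    B ^ p * Y * (X * |U|) ^ (p - 2) * |U| ≤ CE ^ p * (Klam * |U|) ^ (p - 1) := by
  obtain ⟨q, rfl⟩ : ∃ q, p = q + 2 := ⟨p - 2, by omega⟩
  rw [show q + 2 - 2 = q by omega, show q + 2 - 1 = q + 1 by omega]
  have hU : 0 ≤ |U| := abs_nonneg U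
  have hmX : 1 ≤ max 1 X := le_max_left _ _
  have hmY : 1 ≤ max 1 Y := le_max_left _ _
  have hmK : 1 ≤ max 1 Klam⁻¹ := le_max_left _ _
  have hCE0 : 0 ≤ B * max 1 X * max 1 Y * max 1 Klam⁻¹ := by positivity
  -- `X^q ≤ (max 1 X)^{q+2}`, `Y ≤ (max 1 Y)^{q+2}`, `1 ≤ (max 1 Klam⁻¹)^{q+2} Klam^{q+1}`
  have h1 : X ^ q ≤ max 1 X ^ (q + 2) := by
    calc X ^ q ≤ max 1 X ^ q := pow_le_pow_left₀ hX (le_max_right _ _) q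
      _ ≤ max 1 X ^ (q + 2) := pow_le_pow_right₀ hmX (by omega)
  have h2 : Y ≤ max 1 Y ^ (q + 2) := by
    calc Y ≤ max 1 Y := le_max_right _ _
      _ = max 1 Y ^ 1 := (pow_one _).symm
      _ ≤ max 1 Y ^ (q + 2) := pow_le_pow_right₀ hmY (by omega)
  have h3 : 1 ≤ max 1 Klam⁻¹ ^ (q + 2) * Klam ^ (q + 1) := by
    have hk : 1 ≤ max 1 Klam⁻¹ * Klam := by
      rcases le_or_gt 1 Klam with hK1 | hK1
      · calc (1 : ℝ) ≤ Klam := hK1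
          _ = 1 * Klam := (one_mul _).symm
          _ ≤ max 1 Klam⁻¹ * Klam := mul_le_mul_of_nonneg_right hmK hKlam.le
      · have : max 1 Klam⁻¹ = Klam⁻¹ := max_eq_right (by rw [le_inv_comm₀ one_pos hKlam, inv_one]; exact hK1.le)
        rw [this, inv_mul_cancel₀ hKlam.ne']
    calc (1 : ℝ) ≤ (max 1 Klam⁻¹ * Klam) ^ (q + 1) := one_le_pow₀ hk
      _ = max 1 Klam⁻¹ ^ (q + 1) * Klam ^ (q + 1) := mul_pow _ _ _
      _ ≤ max 1 Klam⁻¹ ^ (q + 2) * Klam ^ (q + 1) :=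
          mul_le_mul_of_nonneg_right (pow_le_pow_right₀ hmK (by omega)) (pow_nonneg hKlam.le _)
  -- assemble
  have hCEp : (B * max 1 X * max 1 Y * max 1 Klam⁻¹) ^ (q + 2) ≤ CE ^ (q + 2) := pow_le_pow_left₀ hCE0 hCE _
  calc B ^ (q + 2) * Y * (X * |U|) ^ q * |U|
      = (B ^ (q + 2) * |U| ^ (q + 1)) * (Y * X ^ q) := by rw [mul_pow]; ring
    _ ≤ (B ^ (q + 2) * |U| ^ (q + 1)) * ((max 1 Y ^ (q + 2)) * (max 1 X ^ (q + 2)) * (max 1 Klam⁻¹ ^ (q + 2) * Klam ^ (q + 1))) := by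
        refine mul_le_mul_of_nonneg_left ?_ (by positivity)
        calc Y * X ^ q ≤ max 1 Y ^ (q + 2) * max 1 X ^ (q + 2) := mul_le_mul h2 h1 (pow_nonneg hX q) (by positivity)
          _ = max 1 Y ^ (q + 2) * max 1 X ^ (q + 2) * 1 := (mul_one _).symm
          _ ≤ _ := mul_le_mul_of_nonneg_left h3 (by positivity)
    _ = (B * max 1 X * max 1 Y * max 1 Klam⁻¹) ^ (q + 2) * (Klam * |U|) ^ (q + 1) := by
        simp only [mul_pow]; ring
    _ ≤ CE ^ (q + 2) * (Klam * |U|) ^ (q + 1) := mul_le_mul_of_nonneg_right hCEp (by positivity)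

end Summit.HubbardSuperconductivity.HubbardSuperconductivity.Theorems.EngineV8

end
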